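import Summits.QuantumFields.YangMills.Theorems.FlatTubeReductionPinnedSpanStepDoor
import Summits.QuantumFields.YangMills.Theorems.FlatTubeReductionPinnedUnitStepExGroundState
import Summits.QuantumFields.YangMills.Theorems.FemtoTransferGapEigenbasis
import HarnessLib

/-!
# Route `FlatTubeReduction` (LINE g6-A «unit-slab ladder») — KINEMATICS of the momentum-covariant pinned engines:
# the RAW pull-back has positive variance, so `RawPinnedUnitStep → UnitUpStep` with NO kinematic stub
# (bears on crux `UnitUpStep` stmt-QuantumFields-27556; R2b1 RECORD rung — no summit)

Seat ym-line-fcl-p3 g11 (2026-08-28).  The filed «ti-split» lines carry a KINEMATIC stub (W-inj: the plain translation average of the thinning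
pull-back of a translation-invariant coarse observable is not a.e. constant — landed at `m = 1`, p642758, after a 16-file decimation calculus; open
for general `m`) and hide the hypothesis «the coarse first excitation is translation invariant» (zero-momentum first excitation, no rigorous source).
For the RAW pull-back (`a = δ₀` in `spanTrial`) neither is needed:
* `PinnedSpan.ae_const_of_comp_thin` — `thin L′` is measure preserving (`Thinning.map_thin_configMeasure`), so `g ∘ thin L′` a.e. constant forces
  `g` a.e. constant;
* `PinnedSpan.not_ae_const_ratio` — `φ′ ⊥ Ω′`, `‖φ′‖ = 1`, `Ω′ > 0` ⇒ `φ′/Ω′` is not a.e. constant;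
* ★ `PinnedSpan.l2_rawTrial_sq_lt` — hence `⟨ψ₀,Ω⟩² < ‖ψ₀‖²` for `ψ₀ = ((φ′/Ω′)∘thin L′)·Ω`, for EVERY physical `φ′ ⊥ Ω′` of norm one (any momentum
  content), every `L′ ≤ L ≤ 2L′` (strict Cauchy–Schwarz `GroundStateUnique.l2_mul_sq_lt_of_not_ae_const`);
* `PinnedSpan.spanTrial_single_eq_raw` — `a = δ₀` is the raw pull-back;
* ★★ `PinnedSpan.pinnedSpanUnitStep_of_rawPinnedUnitStep : RawPinnedUnitStep → PinnedSpanUnitStep`, hence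
  ★★ `PinnedSpan.unitUpStep_of_rawPinnedUnitStep : RawPinnedUnitStep → UnitUpStep` and `… → UpStepEv`: a ONE-STUB composition for crux 27556 whose
  only stub is the analytic autocorrelation comparison (candidate skeleton «raw-unit»; the planner decides);
* `PinnedSpan.l2_spanTrial_groundState`, `…_eq_zero`, `PinnedSpan.l2_spanTrial_eq_zero_of_groundState` — translation bookkeeping:
  `⟨ψ_a,Ω⟩ = (Σ_v a v)·⟨ψ₀,Ω⟩`, so MEAN-ZERO coefficients (every momentum-`k ≠ 0` twisted average) give trial vectors orthogonal to the ground state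
  (variance = full norm; no smear-injectivity question arises for them either);
* `PinnedSpan.exists_excitedData` — the coarse data the engines quantify over always exist (positive ground state `Ω′ ≥ c′ > 0` and a normalised
  physical `secondValue′`-eigenfunction `φ′ ⊥ Ω′`, from `PhysL2.exists_groundState`, `exists_isPhys_eigenseq`), so `∃ φ′` is never vacuous and a
  supplier may prove the comparison for the tree's own eigenfunction.
HONEST FRAMING: kinematics and glue only; whether the raw pull-back (leading-order one-gluon leakage `O(ε₁Λ log L′/L′²)` at one doubled slab,
ALIASING.md) or a momentum-twisted average is the right witness is for the analytic supplier; the comparison itself (XL) is OPEN.  Nothing here concerns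
infinite volume, the continuum limit or the Clay Yang–Mills mass gap.
References: M. Lüscher, NPB 219 (1983) 233 [cite: Luscher1983, §3]; M. Reed, B. Simon, vol. IV (1978) [cite: ReedSimonIV1978, Thm. XIII.1].
-/

set_option autoImplicit false

noncomputable section

open MeasureTheory
open Literature.MathematicalPhysics.QuantumFieldTheory (Site Edge GaugeConfig gaugeTransform torusConfigShift torusConfigShift_apply)
open Literature.MathematicalPhysics.QuantumLattice

namespace Summit.QuantumFields.YangMills.Theorems.FlatTubeReduction.PinnedSpan

open Summit.QuantumFields.YangMills.Theorems.FemtoTransferGap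
open Summit.QuantumFields.YangMills.Theses.FlatTubeReduction
open Summit.QuantumFields.YangMills.Theorems.FemtoCutoffLadder
open Summit.QuantumFields.YangMills.Theorems.FemtoCutoffLadder.Thinning (thin)

/-! ## The raw pull-back is never trivial -/

/-- `thin L′` is measure preserving, so a pull-back `g ∘ thin L′` that is a.e. constant on the fine torus comes from a `g` that is a.e. constant
on the coarse torus. [folklore] -/
theorem ae_const_of_comp_thin {L L' : ℕ} [NeZero L] [NeZero L'] (hLL : L' ≤ L) {g : GaugeConfig 3 L' SU2 → ℝ} (hg : Measurable g)
    {c : ℝ} (h : (fun U : GaugeConfig 3 L SU2 => g (thin L' U)) =ᵐ[configMeasure SU2 L] fun _ => c) :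
    g =ᵐ[configMeasure SU2 L'] fun _ => c := by
  rw [← Thinning.map_thin_configMeasure (G := SU2) hLL]
  have hS : MeasurableSet {y : GaugeConfig 3 L' SU2 | g y = (fun _ : GaugeConfig 3 L' SU2 => c) y} :=
    measurableSet_eq_fun hg measurable_const
  exact (ae_map_iff (Thinning.measurable_thin L').aemeasurable hS).2 h

/-- A normalised physical `φ′` orthogonal to a positive normalised `Ω′` has a ground-state ratio `φ′/Ω′` that is NOT a.e. constant. [folklore] -/
theorem not_ae_const_ratio {L' : ℕ} [NeZero L'] {Ω' φ' : GaugeConfig 3 L' SU2 → ℝ} (hpos' : ∀ U', 0 < Ω' U')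
    (hn' : l2 Ω' Ω' = 1) (horth : l2 φ' Ω' = 0) (hn1 : l2 φ' φ' = 1) (c : ℝ) :
    ¬ ((fun U' : GaugeConfig 3 L' SU2 => φ' U' / Ω' U') =ᵐ[configMeasure SU2 L'] fun _ => c) := by
  intro hc
  have hφc : φ' =ᵐ[configMeasure SU2 L'] c • Ω' := hc.mono fun U' hU' => by
    have hne : Ω' U' ≠ 0 := (hpos' U').ne'
    have h' : φ' U' / Ω' U' = c := hU'
    rw [Pi.smul_apply, smul_eq_mul, ← h', div_mul_cancel₀ _ hne]
  have h0 : c = 0 := by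
    have := horth
    rwa [GroundStateUnique.l2_congr_ae_left hφc, l2_smul_left, hn', mul_one] at this
  have hφ0 : φ' =ᵐ[configMeasure SU2 L'] (0 : ℝ) • Ω' := h0 ▸ hφc
  have : l2 φ' φ' = 0 := by
    rw [GroundStateUnique.l2_congr_ae_left hφ0, l2_smul_left, zero_mul]
  rw [this] at hn1
  exact zero_ne_one hn1

/-- ★ **The RAW pinned trial has positive variance — for every coarse excitation, any momentum content.**  For `L′ ≤ L ≤ 2L′`, a positive
normalised physical fine `Ω`, a physical coarse `Ω′ ≥ c′ > 0` of norm one and ANY physical coarse `φ′ ⊥ Ω′` of norm one, the raw pull-back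
`ψ₀ = ((φ′/Ω′) ∘ thin L′)·Ω` satisfies `⟨ψ₀,Ω⟩² < ‖ψ₀‖²` (no translation invariance, no eigen-equation, no smear-injectivity).
[cite: ReedSimonIV1978, Thm. XIII.1] -/
theorem l2_rawTrial_sq_lt {L L' : ℕ} [NeZero L] [NeZero L'] (hLL : L' ≤ L) (h2 : L ≤ 2 * L')
    {Ω : GaugeConfig 3 L SU2 → ℝ} (hΩ : IsPhys Ω) (hpos : ∀ U, 0 < Ω U) (hΩ1 : l2 Ω Ω = 1)
    {Ω' φ' : GaugeConfig 3 L' SU2 → ℝ} (hΩ' : IsPhys Ω') (hφ' : IsPhys φ') {c' : ℝ} (hc' : 0 < c') (hcle' : ∀ U', c' ≤ Ω' U')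
    (hn' : l2 Ω' Ω' = 1) (horth : l2 φ' Ω' = 0) (hn1 : l2 φ' φ' = 1) :
    l2 (fun U => φ' (thin L' U) / Ω' (thin L' U) * Ω U) Ω ^ 2 <
      l2 (fun U => φ' (thin L' U) / Ω' (thin L' U) * Ω U) (fun U => φ' (thin L' U) / Ω' (thin L' U) * Ω U) := by
  obtain ⟨hrm, ⟨Cg, hrb⟩, hrg, hrz, -⟩ := Dirichlet.ratio_multiplier hΩ' hφ' hc' hcle'
  have hratio : IsPhys (fun U' : GaugeConfig 3 L' SU2 => φ' U' / Ω' U') := ⟨hrm, ⟨Cg, hrb⟩, hrg, hrz⟩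
  have hf : IsPhys (fun U : GaugeConfig 3 L SU2 => φ' (thin L' U) / Ω' (thin L' U)) :=
    Thinning.isPhys_comp_thin hLL h2 hratio
  have hpos' : ∀ U', 0 < Ω' U' := fun U' => hc'.trans_le (hcle' U')
  have hfnc : ∀ c : ℝ, ¬ ((fun U : GaugeConfig 3 L SU2 => φ' (thin L' U) / Ω' (thin L' U)) =ᵐ[configMeasure SU2 L] fun _ => c) :=
    fun c hc => not_ae_const_ratio hpos' hn' horth hn1 c (ae_const_of_comp_thin hLL hrm hc)
  exact GroundStateUnique.l2_mul_sq_lt_of_not_ae_const _ Ω hf hΩ hpos hΩ1 hfnc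

/-! ## One-stub composition for crux `UnitUpStep` through the raw engine -/

/-- The coefficient vector `δ₀` gives the raw pull-back: `spanTrial L′ δ₀ g Ω = (g ∘ thin L′)·Ω` (`τ₀ = id`). [folklore] -/
theorem spanTrial_single_eq_raw {L L' : ℕ} [NeZero L] (g : GaugeConfig 3 L' SU2 → ℝ) (Ω : GaugeConfig 3 L SU2 → ℝ) :
    spanTrial L' (fun v : Site 3 L => if v = 0 then (1 : ℝ) else 0) g Ω = fun U => g (thin L' U) * Ω U := by
  classical
  funext U
  simp only [spanTrial, ite_mul, one_mul, zero_mul, Finset.sum_ite_eq', Finset.mem_univ, if_true, torusConfigShift_zero]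

/-- ★★ **`RawPinnedUnitStep → PinnedSpanUnitStep`**: take `a = δ₀`; the variance conjunct is `l2_rawTrial_sq_lt`. [folklore] -/
theorem pinnedSpanUnitStep_of_rawPinnedUnitStep (h : RawPinnedUnitStep) : PinnedSpanUnitStep := by
  classical
  obtain ⟨C, lam0, hlam0, H⟩ := h
  refine ⟨C, lam0, hlam0, fun lam hlam hle => ?_⟩
  obtain ⟨L0, HL⟩ := H lam hlam hle
  refine ⟨L0, fun L' _ hL0 β β' hW hW' hm Ω hΩ hpos hΩ1 heigp Ω' hΩ' c' hc' hcle' hn' heigp' => ?_⟩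
  obtain ⟨φ', hφ', horth, hn1, heigp1, HB⟩ := HL L' hL0 β β' hW hW' hm Ω hΩ hpos hΩ1 heigp Ω' hΩ' c' hc' hcle' hn' heigp'
  simp only [] at HB
  have hLL : L' ≤ L' + 1 := Nat.le_succ _
  have h2 : L' + 1 ≤ 2 * L' := by have := NeZero.one_le (n := L'); omega
  have hvar := l2_rawTrial_sq_lt hLL h2 hΩ hpos hΩ1 hΩ' hφ' hc' hcle' hn' horth hn1
  refine ⟨φ', hφ', horth, hn1, heigp1, fun v => if v = 0 then (1 : ℝ) else 0, ?_⟩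
  simp only []
  rw [spanTrial_single_eq_raw]
  exact ⟨hvar, HB⟩

/-- ★★ **`RawPinnedUnitStep → UnitUpStep`** (candidate one-stub skeleton «raw-unit» of crux stmt-QuantumFields-27556: the only stub is the analytic
autocorrelation comparison for the raw pull-back; no W-inj, no translation-invariant eigenfunction). [cite: Luscher1983, §3] -/
theorem unitUpStep_of_rawPinnedUnitStep (h : RawPinnedUnitStep) : UnitUpStep :=
  unitUpStep_of_pinnedSpanUnitStep (pinnedSpanUnitStep_of_rawPinnedUnitStep h)

/-- `RawPinnedUnitStep → UpStepEv` (shared crux stmt-QuantumFields-26796, through the unit ladder). [folklore] -/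
theorem upStepEv_of_rawPinnedUnitStep (h : RawPinnedUnitStep) : UpStepEv :=
  upStepEv_of_pinnedSpanUnitStep (pinnedSpanUnitStep_of_rawPinnedUnitStep h)

/-! ## Translation bookkeeping: mean-zero coefficients give trial vectors orthogonal to the ground state -/

/-- `⟨spanTrial L′ a g Ω, Ω⟩ = (Σ_v a v)·⟨(g ∘ thin L′)·Ω, Ω⟩` for a translation-invariant physical `Ω` (every translate of the pull-back has the same
`Ω²`-mean: `Thinning`/`torusConfigShift` change of variables). [folklore] -/
theorem l2_spanTrial_groundState {L L' : ℕ} [NeZero L] [NeZero L'] (hLL : L' ≤ L) (h2 : L ≤ 2 * L')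
    {g : GaugeConfig 3 L' SU2 → ℝ} (hg : IsPhys g) {Ω : GaugeConfig 3 L SU2 → ℝ} (hΩ : IsPhys Ω)
    (hΩTI : ∀ (v : Site 3 L) (U : GaugeConfig 3 L SU2), Ω (torusConfigShift v U) = Ω U) (a : Site 3 L → ℝ) :
    l2 (spanTrial L' a g Ω) Ω = (∑ v : Site 3 L, a v) * l2 (fun U => g (thin L' U) * Ω U) Ω := by
  have hterm : ∀ v : Site 3 L, IsPhys (fun U : GaugeConfig 3 L SU2 => g (thin L' (torusConfigShift v U))) :=
    fun v => Thinning.isPhys_thin_shift hLL h2 hg v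
  obtain ⟨CΩ, hCΩ⟩ := hΩ.bounded
  have hΩΩ : IsPhys (fun U => Ω U * Ω U) := IsPhys.mul_of_invariant hΩ hΩ.measurable hCΩ hΩ.gaugeInv hΩ.zeroFlux
  -- every translate has the same `Ω²`-mean
  have hI : ∀ v : Site 3 L, ∫ U, g (thin L' (torusConfigShift v U)) * (Ω U * Ω U) ∂(configMeasure SU2 L) =
      ∫ U, g (thin L' U) * (Ω U * Ω U) ∂(configMeasure SU2 L) := by
    intro v
    have h := integral_comp_torusConfigShift v (fun U : GaugeConfig 3 L SU2 => g (thin L' U) * (Ω U * Ω U))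
    simp only [hΩTI v] at h
    exact h
  have hsum : (fun U => spanTrial L' a g Ω U * Ω U) =
      fun U => ∑ v : Site 3 L, a v * (g (thin L' (torusConfigShift v U)) * (Ω U * Ω U)) := by
    funext U
    simp only [spanTrial, Finset.sum_mul]
    exact Finset.sum_congr rfl fun v _ => by ring
  have hint : ∀ v ∈ (Finset.univ : Finset (Site 3 L)),
      Integrable (fun U => a v * (g (thin L' (torusConfigShift v U)) * (Ω U * Ω U))) (configMeasure SU2 L) :=
    fun v _ => ((hterm v).integrable_mul hΩΩ).const_mul (a v)
  unfold l2
  rw [hsum, integral_finsetSum _ hint]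
  simp only [integral_const_mul, hI, ← Finset.sum_mul]
  congr 1
  exact integral_congr_ae (ae_of_all _ fun U => by ring)

/-- Hence MEAN-ZERO coefficients (`Σ_v a v = 0`: every momentum-twisted average, `a = cos / sin (2πk·v/L)` with `k ≠ 0`, or any difference of
translates) give a trial vector ORTHOGONAL to a translation-invariant `Ω`, so its variance is its full norm `‖ψ_a‖²`. [folklore] -/
theorem l2_spanTrial_groundState_eq_zero {L L' : ℕ} [NeZero L] [NeZero L'] (hLL : L' ≤ L) (h2 : L ≤ 2 * L')
    {g : GaugeConfig 3 L' SU2 → ℝ} (hg : IsPhys g) {Ω : GaugeConfig 3 L SU2 → ℝ} (hΩ : IsPhys Ω)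
    (hΩTI : ∀ (v : Site 3 L) (U : GaugeConfig 3 L SU2), Ω (torusConfigShift v U) = Ω U) {a : Site 3 L → ℝ}
    (ha : ∑ v : Site 3 L, a v = 0) : l2 (spanTrial L' a g Ω) Ω = 0 := by
  rw [l2_spanTrial_groundState hLL h2 hg hΩ hΩTI a, ha, zero_mul]

/-- The engines' fine ground state (positive, normalised, pointwise eigen-equation at `topValue`) is translation invariant
(`GroundStateUnique.groundState_translationInvariant`), so for mean-zero coefficients the pinned trial `spanTrial L′ a (φ′/Ω′) Ω` is orthogonal to it.
[cite: ReedSimonIV1978, Thm. XIII.43] -/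
theorem l2_spanTrial_eq_zero_of_groundState {L L' : ℕ} [NeZero L] [NeZero L'] (hLL : L' ≤ L) (h2 : L ≤ 2 * L') {β : ℝ}
    {Ω : GaugeConfig 3 L SU2 → ℝ} (hΩ : IsPhys Ω) (hpos : ∀ U, 0 < Ω U) (hΩ1 : l2 Ω Ω = 1)
    (heig : ∀ U, ∫ V, transferKernel su2Rep β U V * Ω V ∂(configMeasure SU2 L) = topValue su2Rep L β * Ω U)
    {Ω' φ' : GaugeConfig 3 L' SU2 → ℝ} (hΩ' : IsPhys Ω') (hφ' : IsPhys φ') {c' : ℝ} (hc' : 0 < c') (hcle' : ∀ U', c' ≤ Ω' U')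
    {a : Site 3 L → ℝ} (ha : ∑ v : Site 3 L, a v = 0) :
    l2 (spanTrial L' a (fun U' => φ' U' / Ω' U') Ω) Ω = 0 := by
  obtain ⟨hrm, ⟨Cg, hrb⟩, hrg, hrz, -⟩ := Dirichlet.ratio_multiplier hΩ' hφ' hc' hcle'
  have hratio : IsPhys (fun U' : GaugeConfig 3 L' SU2 => φ' U' / Ω' U') := ⟨hrm, ⟨Cg, hrb⟩, hrg, hrz⟩
  have hΩTI : ∀ (v : Site 3 L) (U : GaugeConfig 3 L SU2), Ω (torusConfigShift v U) = Ω U := fun v U => by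
    rw [torusConfigShift_eq_pinnedInline]
    exact GroundStateUnique.groundState_translationInvariant β hΩ hpos hΩ1 heig v U
  exact l2_spanTrial_groundState_eq_zero hLL h2 hratio hΩ hΩTI ha

/-! ## The quantified coarse data always exist -/

/-- The coarse data of the engines are never vacuous: for every `L′` and `β′ > 0` there are a positive normalised physical ground state
`Ω′ ≥ c′ > 0` (pointwise eigen-equation at `topValue`) and a normalised physical `secondValue′`-eigenfunction `φ′ ⊥ Ω′` (pointwise eigen-equation)
— Jentzsch/Perron–Frobenius (`PhysL2.exists_groundState`) and the Hilbert–Schmidt eigenbasis (`exists_isPhys_eigenseq`, `levelValue_one`,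
orthogonality of eigenfunctions with distinct eigenvalues `PhysL2.secondValue_lt_topValue`). [cite: ReedSimonIV1978, Thm. XIII.1] -/
theorem exists_excitedData (L' : ℕ) [NeZero L'] {β' : ℝ} (hβ' : 0 < β') :
    ∃ (Ω' φ' : GaugeConfig 3 L' SU2 → ℝ) (c' : ℝ), IsPhys Ω' ∧ 0 < c' ∧ (∀ U', c' ≤ Ω' U') ∧ l2 Ω' Ω' = 1 ∧
      (∀ U', ∫ V', transferKernel su2Rep β' U' V' * Ω' V' ∂(configMeasure SU2 L') = topValue su2Rep L' β' * Ω' U') ∧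
      IsPhys φ' ∧ l2 φ' Ω' = 0 ∧ l2 φ' φ' = 1 ∧
      (∀ U', ∫ V', transferKernel su2Rep β' U' V' * φ' V' ∂(configMeasure SU2 L') = secondValue su2Rep L' β' * φ' U') := by
  obtain ⟨Ω', θ', c', hΩ', hc', hcle', hn', heig', -, -, -⟩ := PhysL2.exists_groundState (L := L') β'
  obtain ⟨e, hon, heige, -, -⟩ := exists_isPhys_eigenseq (L := L') hβ'
  set φ' : GaugeConfig 3 L' SU2 → ℝ := ((e 1 : physSubmodule L') : GaugeConfig 3 L' SU2 → ℝ) with hφ'def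
  have hφ' : IsPhys φ' := (e 1).2
  have hn1 : l2 φ' φ' = 1 := by have := hon 1 1; simpa using this
  have heig1 : transferApply β' φ' = secondValue su2Rep L' β' • φ' := by
    rw [← levelValue_one]; exact heige 1
  have horth : l2 φ' Ω' = 0 :=
    Dirichlet.l2_eq_zero_of_eigen_ne β' hφ' hΩ' heig1 heig' (PhysL2.secondValue_lt_topValue (L := L') β').ne
  have heigp' : ∀ U', ∫ V', transferKernel su2Rep β' U' V' * Ω' V' ∂(configMeasure SU2 L') = topValue su2Rep L' β' * Ω' U' :=
    fun U => by simpa [transferApply] using congrFun heig' U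
  have heigp1 : ∀ U', ∫ V', transferKernel su2Rep β' U' V' * φ' V' ∂(configMeasure SU2 L') = secondValue su2Rep L' β' * φ' U' :=
    fun U => by simpa [transferApply] using congrFun heig1 U
  exact ⟨Ω', φ', c', hΩ', hc', hcle', hn', heigp', hφ', horth, hn1, heigp1⟩

end Summit.QuantumFields.YangMills.Theorems.FlatTubeReduction.PinnedSpan

end
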